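import Literature.NumberTheory.Automorphic.UnitaryThreeRamifiedTorusDoubleCosetsHKDisjoint   -- ★ hB′ p841677 (`v_eq_one_of_v_sub_eq_one`; + γ2b-A, γ2a, γ0, (F1))
import Literature.NumberTheory.Automorphic.UnitaryThreeTorusLatticeBridge                -- ★ bridge p841371 (`v_le_one`, `exists_lift_fixed`)
import HarnessLib

/-!
# The type-(2) (RAMIFIED) torus `T_H = Z_H(t′)`: shape, valuations, the coordinate `y = q∕(dp)`, integrality of the `r_j`-conjugates, and an index-by-range lemma
(Flicker (1998), *Elementary proof of the fundamental lemma for a unitary group*, Prop. 6 (c) p. 83 for the type-(2) torus: `[T_H : T_H ∩ r_jK_Hr_j⁻¹] = q^j`)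

Topic `NumberTheory/Automorphic`; namespace `Literature.NumberTheory.Automorphic.UnitaryGroup`.  KERNEL mathematics only: theorems, no definition, no
named fact, no instance, no notation, no `sorry`.  Cell `pub/hodgecm-mathlib`, programme P3a, road «D-N7-inert», MAP v3 «N7-ns COUNT FROM FLICKER», brick
γ2′ «THE RAMIFIED ∕ TYPE-(2) TRANSPORT» — FILE `weight′` PART 1 (preliminaries); PART 2 `UnitaryThreeRamifiedTorusDoubleCosetsHKWeight` proves the weight
`relIndex = q₀^j` (A-p03 (g24) 06:08:25Z: «q^j exactly, every j»; consumer ★ B-p14 `sum_pow_mul_innerSumTen_eq_phiTH`, B-p04's ★ p840967).  HC_CM is proved only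
modulo the printed citations (2 remaining named inputs hLiu418, h413) until rung 0 closes; this file discharges no named fact.

CONTENTS.  §1 `index_eq_natCard_range` — `[G : S] = #range f` for any map `f` on `G` with `f a = f b ⟺ a⁻¹b ∈ S` (cosets counted by an invariant; no homomorphism
needed — the type-(2) torus has NO split eigenvalues in `K`, so the weight is counted through the coordinate `y = q∕(dp) ∈ F` and its TWISTED addition law
`y₁₂ = (y₁ + y₂)∕(1 + π₀y₁y₂)` instead of a character).  §2 `TorusBridge.mem_maximalIdeal_pow_iff_v_le` — `x ∈ 𝔪^j ⟺ |ι x| ≤ |ι ϖ_R|^j` (bridge).  §3 the torus blocks: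
`exists_coe_eq_rtorus_of_mem_centralizer` (shape `!![p,0,ρq;0,e,0;q,0,p]`), `rtorus_v_facts` (`|p| = 1`, `|q| ≤ 1`, `|e| = 1`, `σ(q∕(dp)) = q∕(dp)`).  §4 integrality of
the conjugates `r_j⁻¹ τ r_j`: `forall_v_conjEven_le_one_iff` (`j = 2a`: `⟺ |q| ≤ |ϖ^a|²`), `forall_v_conjOdd_le_one_iff` (`j = 2a+1`: `⟺ |ρ||q| ≤ |ϖ^{a+1}|²`).

References: [Flicker1998UnitaryFL] Y. Z. Flicker, Canad. J. Math. 50 (1998), Prop. 6 (c) p. 83, Prop. 7 p. 84 · [Serre1979] J.-P. Serre, *Local Fields*, GTM 67,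
Ch. V §2 · [Rogawski1990] J. D. Rogawski, Ann. of Math. Stud. 123, §4.9 p. 55. -/

set_option autoImplicit false

open Matrix
open scoped MatrixGroups WithZero

namespace Literature.NumberTheory.Automorphic.UnitaryGroup

open Literature.NumberTheory.Automorphic.HermitianLattice (unitaryInt LocalConjDatum)
open IsLocalRing

universe u

/-! ## §1 Counting cosets by an invariant -/

/-- **`[G : S] = #range f`** whenever `f a = f b ⟺ a⁻¹ b ∈ S`: `aS ↦ f a` is a well-defined bijection `G ⧸ S ≃ range f`. [cite: Flicker1998UnitaryFL, Prop. 6 (c) p. 83] -/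
theorem index_eq_natCard_range {G : Type*} [Group G] {X : Type*} (S : Subgroup G) (f : G → X)
    (hf : ∀ a b : G, f a = f b ↔ a⁻¹ * b ∈ S) : S.index = Nat.card (Set.range f) := by
  classical
  unfold Subgroup.index
  refine Nat.card_congr (Equiv.ofBijective (fun x : G ⧸ S => Quotient.liftOn' x (fun a => (⟨f a, a, rfl⟩ : Set.range f))
      (fun a b h => Subtype.ext ((hf a b).2 (QuotientGroup.eq.1 (Quotient.sound' h))))) ⟨?_, ?_⟩)
  · intro x y hxy
    induction x using Quotient.inductionOn' with | h a => ?_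
    induction y using Quotient.inductionOn' with | h b => ?_
    exact QuotientGroup.eq.2 ((hf a b).1 (congrArg Subtype.val hxy))
  · rintro ⟨x, a, rfl⟩
    exact ⟨(a : G ⧸ S), rfl⟩

/-! ## §2 `𝔪^j` read in `K` -/

section Bridge

variable {K : Type*} [Field K] [Valued K ℤᵐ⁰]
  {R : Type u} [CommRing R] (ι : R →+* K) (hι : Function.Injective ι) (hιv : ∀ x : K, Valued.v x ≤ 1 ↔ x ∈ Set.range ι)

include hι hιv in
/-- `x ∈ 𝔪^j ⟺ |ι x| ≤ |ι ϖ_R ^ j|` (`ϖ_R` a uniformiser of the DVR `R`, `ι : R ↪ K` onto `{|·| ≤ 1}`). [cite: Serre1979, Ch. II §3 Prop. 5] -/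
theorem TorusBridge.mem_maximalIdeal_pow_iff_v_le [IsDomain R] [IsDiscreteValuationRing R] {ϖR : R} (hϖR : Irreducible ϖR) (j : ℕ) (x : R) :
    x ∈ maximalIdeal R ^ j ↔ Valued.v (ι x) ≤ Valued.v (ι ϖR ^ j) := by
  rw [Irreducible.maximalIdeal_eq hϖR, Ideal.span_singleton_pow, Ideal.mem_span_singleton]
  constructor
  · rintro ⟨y, hy⟩
    rw [hy, map_mul, map_mul, map_pow ι]
    exact mul_le_of_le_one_right zero_le (TorusBridge.v_le_one ι hιv y)
  · intro h
    by_cases hx : x = 0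
    · rw [hx]; exact dvd_zero _
    have hne : ι (ϖR ^ j) ≠ 0 := by
      rw [map_pow]; exact pow_ne_zero _ fun h0 => hϖR.ne_zero (hι (by rw [h0, map_zero]))
    obtain ⟨y, hy⟩ := (hιv (ι x / ι (ϖR ^ j))).1 (by rw [map_div₀, map_pow ι]; exact div_le_one_of_le₀ h zero_le)
    exact ⟨y, hι (by rw [map_mul, hy, mul_div_cancel₀ _ hne])⟩

end Bridge

/-! ## §3 The ramified torus blocks `!![p, 0, ρq; 0, e, 0; q, 0, p]` -/

section Torus

variable {K : Type*} [Field K] (σ : K →+* K) {J : Matrix (Fin 3) (Fin 3) K} (hJ : J = (StdForm.antidiagonal 3).over K)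

/-- **Shape of `Z_H(t′)`** for the type-(2) torus block `t′ = !![A,0,B;0,b,0;C,0,A]` (`C ≠ 0`, `B = Cρ`): an element of `H` commuting with `t′` is
`!![p, 0, ρq; 0, e, 0; q, 0, p]` with `p, q` its `(0,0)`, `(2,0)` entries (★ `mem_centralizer_block_iff`). [cite: Flicker1998UnitaryFL, Prop. 6 p. 83] -/
theorem exists_coe_eq_rtorus_of_mem_centralizer (h2 : (2 : K) ≠ 0) {c t τ : ↥(unitaryGroupOfForm σ J)}
    (hc : ((c : GL (Fin 3) K) : Matrix (Fin 3) (Fin 3) K) = !![1, 0, 0; 0, -1, 0; 0, 0, 1]) {ρ A B C b : K}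
    (hte : ((t : GL (Fin 3) K) : Matrix (Fin 3) (Fin 3) K) = !![A, 0, B; 0, b, 0; C, 0, A]) (hC : C ≠ 0) (hB : B = C * ρ)
    (hτH : τ ∈ Subgroup.centralizer ({c} : Set ↥(unitaryGroupOfForm σ J))) (hτt : τ ∈ Subgroup.centralizer ({t} : Set ↥(unitaryGroupOfForm σ J))) :
    ∃ e : K, ((τ : GL (Fin 3) K) : Matrix (Fin 3) (Fin 3) K) =
      !![((τ : GL (Fin 3) K) : Matrix (Fin 3) (Fin 3) K) 0 0, 0, ρ * ((τ : GL (Fin 3) K) : Matrix (Fin 3) (Fin 3) K) 2 0; 0, e, 0;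
        ((τ : GL (Fin 3) K) : Matrix (Fin 3) (Fin 3) K) 2 0, 0, ((τ : GL (Fin 3) K) : Matrix (Fin 3) (Fin 3) K) 0 0] := by
  obtain ⟨α, β, γ, δ, e, hτ⟩ := exists_coe_eq_block_of_mem_centralizer σ h2 hc hτH
  obtain ⟨hαδ, hβγ⟩ := (mem_centralizer_block_iff σ hτ hte hC).1 hτt
  have hβ : β = ρ * γ := mul_right_cancel₀ hC (by rw [hβγ, hB]; ring)
  refine ⟨e, ?_⟩
  rw [hτ]; simp [hαδ, hβ]

end Torus

section TorusVal

variable {K : Type*} [Field K] [Valued K ℤᵐ⁰] {ϖ : K} (σ : K →+* K) {J : Matrix (Fin 3) (Fin 3) K}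
  (hJ : J = (StdForm.antidiagonal 3).over K) (hd : LocalConjDatum σ ϖ)

include hJ hd in
/-- **Valuations on the type-(2) torus**: for `τ = !![p,0,ρq;0,e,0;q,0,p] ∈ U(Φ₃)` with `|ρ| = |ϖ|` (odd): `|p| = 1` (★ hB′), `|q| ≤ 1` (`|ρq²| ≤ 1`, discreteness),
`|e| = 1`, `p ≠ 0`, and the coordinate `y = q∕(dp)` is `σ`-FIXED (`σp·Δ = p`, `σq·Δ = −q`, `σd = −d`) — `y ∈ F`, the additive parameter of `T_H ≅ ι(L^×)`.
[cite: Flicker1998UnitaryFL, Prop. 6 p. 83] -/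
theorem rtorus_v_facts {d ρ : K} (hdK : σ d = -d) (hd0 : d ≠ 0) (hρ : Valued.v ρ = Valued.v ϖ) {τ : ↥(unitaryGroupOfForm σ J)} {p q e : K}
    (hτ : ((τ : GL (Fin 3) K) : Matrix (Fin 3) (Fin 3) K) = !![p, 0, ρ * q; 0, e, 0; q, 0, p]) :
    Valued.v p = 1 ∧ Valued.v q ≤ 1 ∧ Valued.v e = 1 ∧ p ≠ 0 ∧ σ (q / (d * p)) = q / (d * p) := by
  have hτ3 : ((τ : GL (Fin 3) K)) ∈ unitaryGroupOfForm σ ((StdForm.antidiagonal 3).over K) := by rw [← hJ]; exact τ.2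
  obtain ⟨⟨R1, R2, R3, R4⟩, he⟩ := SplitDictionary.rel_of_coe_eq_block σ hτ3 hτ
  have hΔ := SplitDictionary.det_ne_zero σ R1 R2
  have hN := SplitDictionary.det_mul_map_det σ R1 R2 R3 R4
  have hv1 : ∀ {x : K}, x * σ x = 1 → Valued.v x = 1 := by
    intro x hx
    have h1 := congrArg Valued.v hx
    rw [map_mul, hd.vσ, map_one] at h1
    exact Literature.NumberTheory.QuadraticForms.OMeara65.WithZeroMulInt.eq_one_of_mul_self h1
  have hvΔ : Valued.v (p * p - ρ * q * q) = 1 := hv1 hN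
  have hvp : Valued.v p = 1 := v_eq_one_of_v_sub_eq_one σ hd hρ hvΔ
  have hp0 : p ≠ 0 := fun h0 => by rw [h0, map_zero] at hvp; exact zero_ne_one hvp
  refine ⟨hvp, ?_, hv1 (by rw [mul_comm]; exact he), hp0, ?_⟩
  · -- `|ρ q q| ≤ 1` and `|ρ| = exp(−1)`
    by_cases hq : q = 0
    · rw [hq, map_zero]; exact zero_le
    have hvq0 : Valued.v q ≠ 0 := (Valuation.ne_zero_iff _).2 hq
    have h1 : Valued.v (ρ * q * q) ≤ 1 := by
      have e1 : ρ * q * q = p * p - (p * p - ρ * q * q) := by ring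
      rw [e1]
      refine (Valuation.map_sub _ _ _).trans ?_
      rw [map_mul, hvp, one_mul, hvΔ, max_self]
    rw [map_mul, map_mul, hρ, hd.vϖ, ← WithZero.exp_log hvq0, ← WithZero.exp_add, ← WithZero.exp_add, ← WithZero.exp_zero,
      WithZero.exp_le_exp] at h1
    rw [← WithZero.exp_log hvq0, ← WithZero.exp_zero, WithZero.exp_le_exp]
    omega
  · have ha := SplitDictionary.map_a_mul_det σ R1 R2   -- σp Δ = p
    have hc' := SplitDictionary.map_c_mul_det σ R1 R2  -- σq Δ = −q
    have eσp : σ p = p / (p * p - ρ * q * q) := by rw [eq_div_iff hΔ]; exact ha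
    have eσq : σ q = -q / (p * p - ρ * q * q) := by rw [eq_div_iff hΔ]; exact hc'
    have hΔ' : p ^ 2 - q ^ 2 * ρ ≠ 0 := fun h0 => hΔ (by linear_combination h0)
    rw [map_div₀, map_mul, hdK, eσp, eσq]
    field_simp

end TorusVal

/-! ## §4 Integrality of the `r_j`-conjugates -/

section Conj

variable {K : Type*} [Field K] [Valued K ℤᵐ⁰]

/-- **`j = 2a`**: `r(2a)⁻¹ τ r(2a) = !![p, 0, ϖ^a ρq ϖ^a; 0, e, 0; ϖ^{−a} q ϖ^{−a}, 0, p]` is integral iff `|q| ≤ |ϖ^a|²` (`|p| ≤ 1`, `|e| = 1`, `|ρ| ≤ 1`).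
[cite: Flicker1998UnitaryFL, Prop. 6 (c) p. 83] -/
theorem forall_v_conjEven_le_one_iff {p q e ρ ϖ : K} {a : ℕ} (hϖ0 : ϖ ≠ 0) (hvϖ : Valued.v ϖ ≤ 1) (hvp : Valued.v p ≤ 1)
    (hve : Valued.v e = 1) (hvρ : Valued.v ρ ≤ 1) :
    (∀ x y : Fin 3, Valued.v ((!![p, 0, ϖ ^ a * (ρ * q) * ϖ ^ a; 0, e, 0; (ϖ ^ a)⁻¹ * q * (ϖ ^ a)⁻¹, 0, p] :
        Matrix (Fin 3) (Fin 3) K) x y) ≤ 1) ↔ Valued.v q ≤ Valued.v (ϖ ^ a) * Valued.v (ϖ ^ a) := by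
  have hϖa0 : ϖ ^ a ≠ 0 := pow_ne_zero _ hϖ0
  have hva0 : Valued.v (ϖ ^ a * ϖ ^ a) ≠ 0 := (Valuation.ne_zero_iff _).2 (mul_ne_zero hϖa0 hϖa0)
  have hva1 : Valued.v (ϖ ^ a) ≤ 1 := by rw [map_pow]; exact pow_le_one₀ zero_le hvϖ
  have e20 : (ϖ ^ a)⁻¹ * q * (ϖ ^ a)⁻¹ = q / (ϖ ^ a * ϖ ^ a) := by field_simp
  have key : Valued.v ((ϖ ^ a)⁻¹ * q * (ϖ ^ a)⁻¹) ≤ 1 ↔ Valued.v q ≤ Valued.v (ϖ ^ a) * Valued.v (ϖ ^ a) := by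
    rw [e20, map_div₀, div_le_one₀ (zero_lt_iff.2 hva0), map_mul]
  constructor
  · intro h
    exact key.1 (h 2 0)
  · intro hq x y
    have hq1 : Valued.v q ≤ 1 := hq.trans (mul_le_one' hva1 hva1)
    have hva1' : Valued.v ϖ ^ a ≤ 1 := pow_le_one₀ zero_le hvϖ
    have h02 : Valued.v (ϖ ^ a * (ρ * q) * ϖ ^ a) ≤ 1 := by
      rw [map_mul, map_mul, map_mul, map_pow]
      exact mul_le_one' (mul_le_one' hva1' (mul_le_one' hvρ hq1)) hva1'
    have h20 : Valued.v ((ϖ ^ a)⁻¹ * q * (ϖ ^ a)⁻¹) ≤ 1 := key.2 hq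
    fin_cases x <;> fin_cases y <;> first | exact hvp | exact hve.le | exact h02 | exact h20 | simp

/-- **`j = 2a+1`**: `r(2a+1)⁻¹ τ r(2a+1) = !![p, 0, −qϖ^{a+1}ϖ^{a+1}∕d²; 0, e, 0; −ρqd²∕(ϖ^{a+1}ϖ^{a+1}), 0, p]` is integral iff `|ρ|·|q| ≤ |ϖ^{a+1}|²`
(`|p| ≤ 1`, `|e| = 1`, `|q| ≤ 1`, `|d| = 1`). [cite: Flicker1998UnitaryFL, Prop. 6 (c) p. 83] -/
theorem forall_v_conjOdd_le_one_iff {p q e ρ ϖ d : K} {a : ℕ} (hϖ0 : ϖ ≠ 0) (hvϖ : Valued.v ϖ ≤ 1) (hvp : Valued.v p ≤ 1)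
    (hve : Valued.v e = 1) (hvq : Valued.v q ≤ 1) (hvd : Valued.v d = 1) :
    (∀ x y : Fin 3, Valued.v ((!![p, 0, -(q * ϖ ^ (a + 1) * ϖ ^ (a + 1) / d ^ 2); 0, e, 0;
        -(ρ * q * d ^ 2 / (ϖ ^ (a + 1) * ϖ ^ (a + 1))), 0, p] : Matrix (Fin 3) (Fin 3) K) x y) ≤ 1) ↔
      Valued.v ρ * Valued.v q ≤ Valued.v (ϖ ^ (a + 1)) * Valued.v (ϖ ^ (a + 1)) := by
  have hϖa0 : ϖ ^ (a + 1) ≠ 0 := pow_ne_zero _ hϖ0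
  have hva0 : Valued.v (ϖ ^ (a + 1) * ϖ ^ (a + 1)) ≠ 0 := (Valuation.ne_zero_iff _).2 (mul_ne_zero hϖa0 hϖa0)
  have key : Valued.v (-(ρ * q * d ^ 2 / (ϖ ^ (a + 1) * ϖ ^ (a + 1)))) ≤ 1 ↔
      Valued.v ρ * Valued.v q ≤ Valued.v (ϖ ^ (a + 1)) * Valued.v (ϖ ^ (a + 1)) := by
    rw [Valuation.map_neg, map_div₀, div_le_one₀ (zero_lt_iff.2 hva0), map_mul, map_mul, map_mul, map_pow, hvd, one_pow, mul_one]
  constructor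
  · intro h
    exact key.1 (h 2 0)
  · intro hq x y
    have hva1' : Valued.v ϖ ^ (a + 1) ≤ 1 := pow_le_one₀ zero_le hvϖ
    have h02 : Valued.v (-(q * ϖ ^ (a + 1) * ϖ ^ (a + 1) / d ^ 2)) ≤ 1 := by
      rw [Valuation.map_neg, map_div₀, map_pow, hvd, one_pow, div_one, map_mul, map_mul, map_pow]
      exact mul_le_one' (mul_le_one' hvq hva1') hva1'
    have h20 := key.2 hq
    fin_cases x <;> fin_cases y <;> first | exact hvp | exact hve.le | exact h02 | exact h20 | simp

end Conj

end Literature.NumberTheory.Automorphic.UnitaryGroup
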